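import Summits.Ventures.PercRepro.RankLevelSetExplicitLin2KeyG

/-!
# PercRepro — THE LARGE-CORANK THEOREM WITH ITS OWN THRESHOLD, AND THE LEVEL FROM ANY KEY ROW WITH ANY LARGE-CORANK LAW (p9, S4)

`proofs/SUBCLAIM-S4-p9.md` §S4.2⁗‴. The large-corank theorem `c025_core_explicit_large'` (RankLevelSetExplicitCells) closes the
`e`-free core cells of corank `> q + 2^q` from `p ≥ N₁(q) = 2^{q+1} + 2q² + 4q + 4` — the rank at which the crude arithmetic
`regime_one` gives `8(q+1)·2^{2^q−1−q}·n^q ≤ 2^n`. That inequality is monotone in `n` beyond `2q` (THE DECAY LEMMA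
`add_pow_le_pow_mul_two_pow`: `(m + t)^q ≤ m^q·2^t` for `2q ≤ m`), so ONE kernel evaluation at a base `m` gives it for every
`n ≥ m` (`regime_one_of_base`), and the theorem holds from any such base (`c025_core_explicit_large_of`): at `q = 10`, `m = 2,126`
instead of `2,292`; at `q = 11`, `4,309` instead of `4,386` — exactly the quartic floors of S4's rows, which `N₁` would otherwise
cap. `c025_level_succ_of_key_row'` is `c025_level_succ_of_key_row` with the large-corank theorem as a hypothesis `hlarge`.
Axioms: standard.
-/

open scoped Matroid

namespace PercRepro

namespace ThmN

namespace Explicit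

/-- **REGIME ONE FROM A BASE**: `8(q+1)·2^{2^q−1−q}·n^q ≤ 2^n` for every `n ≥ m` once it holds at `n = m` and `2q ≤ m`
(the decay lemma: `(m + t)^q ≤ m^q·2^t`). -/
theorem regime_one_of_base (q m : ℕ) (hm : 2 * q ≤ m)
    (hbase : 8 * (q + 1) * 2 ^ (2 ^ q - 1 - q) * m ^ q ≤ 2 ^ m) :
    ∀ n, m ≤ n → 8 * (q + 1) * 2 ^ (2 ^ q - 1 - q) * n ^ q ≤ 2 ^ n := by
  intro n hn
  obtain ⟨t, rfl⟩ := Nat.exists_eq_add_of_le hn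
  calc 8 * (q + 1) * 2 ^ (2 ^ q - 1 - q) * (m + t) ^ q
      ≤ 8 * (q + 1) * 2 ^ (2 ^ q - 1 - q) * (m ^ q * 2 ^ t) :=
        Nat.mul_le_mul_left _ (add_pow_le_pow_mul_two_pow m q hm t)
    _ = (8 * (q + 1) * 2 ^ (2 ^ q - 1 - q) * m ^ q) * 2 ^ t := by ring
    _ ≤ 2 ^ m * 2 ^ t := Nat.mul_le_mul_right _ hbase
    _ = 2 ^ (m + t) := by rw [pow_add]

end Explicit

variable {α : Type}

/-- **THE LARGE-CORANK CORE FROM ANY THRESHOLD OF REGIME ONE**: corank `≥ q + 2^q + 1`, `p ≥ N₁` with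
`8(q+1)·2^{2^q−1−q}·n^q ≤ 2^n` for every `n ≥ N₁`, and `p ≥ 2^{q+1} + 3q + 2` (regime two, `q ≥ 3`) —
`c025_core_explicit_large'` with `N₁` a parameter. -/
theorem c025_core_explicit_large_of (q : ℕ) (hq : 3 ≤ q) (N₁ : ℕ)
    (hN₁ : ∀ n, N₁ ≤ n → 8 * (q + 1) * 2 ^ (2 ^ q - 1 - q) * n ^ q ≤ 2 ^ n)
    (M : Matroid α) [M.Finite] (p : ℕ) (hp : N₁ ≤ p) (hp2 : 2 ^ (q + 1) + 3 * q + 2 ≤ p)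
    (hR : M.eRank = (p : ℕ∞)) (hbig : p + q + 2 ^ q < M.E.ncard)
    (hfree : ∀ e ∈ M.E, ∃ A ⊆ M.E \ {e}, e ∉ M.closure A ∧ e ∉ M.closure ((M.E \ {e}) \ A)) :
    RLS M p q := by
  have hq1 := Explicit.succ_le_two_pow q
  refine core_all_corank_of_thresholds_of_bound q (2 ^ q - 1) (by omega) (by omega) N₁ (2 ^ (q + 1) + 3 * q + 2)
    hN₁ (fun p' hp' => Explicit.regime_two q (by omega) p' hp') M p ?_ hR ?_ hfree ?_
  · have h2 : 2 ^ q + 2 ≤ 2 ^ (q + 1) + 3 * q + 2 := by rw [pow_succ]; omega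
    exact max_le (max_le hp hp2) (h2.trans hp2)
  · omega
  · intro j hj X hX hr
    have hL := not_isLoop_of_free M hfree
    have h1 := ncard_add_one_le_two_pow_of_eRk_le M hL hfree j X hX hr
    have h2 := Explicit.two_pow_add_le_two_pow_add j q hj
    omega

/-- **THE LEVEL FROM ONE EVALUATED ROW OF ANY KEY, WITH ANY LARGE-CORANK LAW**: `c025_level_succ_of_key_row` with the
large-corank theorem as the hypothesis `hlarge` (the coranks `> q + 1 + 2^{q+1}` at every `p ≥ p₀`). -/
theorem c025_level_succ_of_key_row' (q : ℕ) (hq : 7 ≤ q) (p₀ : ℕ) (K : ℕ → ℕ → Prop)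
    (hlarge : ∀ (M : Matroid α) [M.Finite] (p : ℕ), p₀ ≤ p → M.eRank = (p : ℕ∞) →
      p + (q + 1) + 2 ^ (q + 1) < M.E.ncard →
      (∀ e ∈ M.E, ∃ A ⊆ M.E \ {e}, e ∉ M.closure A ∧ e ∉ M.closure ((M.E \ {e}) \ A)) → RLS M p (q + 1))
    (htail : 2 * (q + 1 + 2 ^ (q + 1)) + 3 * (q + 1) + 5 ≤ p₀)
    (hmono : ∀ p d, q + 1 ≤ d → K p d → K (p + 1) d)
    (hcore : ∀ (M : Matroid α) [M.Finite] (p d : ℕ), q + 2 ≤ d → d ≤ q + 1 + 2 ^ (q + 1) →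
      2 * d + 3 * (q + 1) + 5 ≤ p → K p d → M.eRank = (p : ℕ∞) → M.E.ncard = p + d →
      (∀ e ∈ M.E, ∃ A ⊆ M.E \ {e}, e ∉ M.closure A ∧ e ∉ M.closure ((M.E \ {e}) \ A)) → RLS M p (q + 1))
    (hrow : ∀ t < 2 ^ (q + 1), K p₀ (q + 2 + t))
    (hprev : ∀ (M : Matroid α) [M.Finite] (p : ℕ), p₀ - 1 ≤ p → RLS M p q) :
    ∀ (M : Matroid α) [M.Finite] (p : ℕ), p₀ ≤ p → RLS M p (q + 1) := by
  intro M _ p hp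
  have h2q : 2 ≤ 2 ^ (q + 1 + 1) := by
    calc 2 = 2 ^ 1 := by norm_num
      _ ≤ 2 ^ (q + 1 + 1) := Nat.pow_le_pow_right (by norm_num) (by omega)
  refine rls_succ_large_at (α := α) q (q + 1) p (by omega) (fun M' _ => hprev M' (p - 1) (by omega)) ?_ ?_ M
  · intro M' _ hn
    rcases Nat.lt_or_ge M'.E.ncard (p + (q + 1)) with h | h
    · exact RLS_of_ncard_lt M' h
    · exact RLS_of_ncard_eq M' (by omega)
  · intro M' _ hR hbig hfree
    rcases Nat.lt_or_ge M'.E.ncard (p + (q + 1) + 2 ^ (q + 1) + 1) with h | h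
    · have hkey0 := hrow (M'.E.ncard - p - (q + 2)) (by omega)
      rw [show q + 2 + (M'.E.ncard - p - (q + 2)) = M'.E.ncard - p by omega] at hkey0
      have hkey := key_mono_of_succ K (M'.E.ncard - p) (fun p' => hmono p' (M'.E.ncard - p) (by omega)) p₀ p hp hkey0
      exact hcore M' p (M'.E.ncard - p) (by omega) (by omega) (by omega) hkey hR (by omega) hfree
    · exact hlarge M' p hp hR (by omega) hfree

end ThmN

end PercRepro
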